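import Summits.QuantumAdvantage.AdviceFreeQNC0.WalkCharactersK
import HarnessLib

/-!
# Cell qa-qnc0 (odd primes, rung F-Q2): the RANK FORM over a general field `K`
# — `h_{D'}(Y) ≤ #E` whenever every degree-`D'` polynomial vanishing on `E` has no `Y`-frequencies

α's rank form (`WalkTubeRank.TubeRank.hilbertFn_far_le_card_failSet`, over `𝔽₂ ⊂ 𝔽₄` with a
twisted trace) redone `K`-LINEARLY for any field `K` and `ω : K` with `ω² + ω + 1 = 0`, `3 ≠ 0`
(prover memo HOME/qa-qnc0-prover/PROVER-MEMO-gen10.md §3/§5(b)):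

* `thetaK ω Y` — the normalised coefficient transform `Θ_Y(Q)(a) = [a ∈ Y]·κ(a)⁻¹·L_a(Q)`,
  `κ(a) = Πᵢ κ(aᵢ)` (`WalkCharactersK.LfunK_mono`), a `K`-linear map `CubeFn K m → (patterns → K)`;
* `thetaK_mono` — **unitriangularity**: `Θ_Y(u^S) = Σ_{T ⊆ S} (τ₂−τ₁)^{|T|} τ₁^{|S∖T|} · e_T|_Y`
  with `τ(aᵢ) = σ(aᵢ)/κ(aᵢ)`, `τ₂ − τ₁ ≠ 0`; hence `eYK_mem_range`, `map_projOn_le_range`: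
  `(lowDeg D')|_Y ⊆ Θ_Y(lowDeg D')`;
* **`hilbertFn_le_card_of_vanish`** — if every `Q ∈ lowDeg K m D'` vanishing on `E` has
  `L_a(Q) = 0` for all `a ∈ Y`, then `hilbertFn K Y D' ≤ #E` (rank–nullity:
  `h_{D'}(Y) ≤ rank Θ_Y ≤ rank(·|_E) ≤ #E`);
* **`card_mul_numMonomials_le_of_vanish`** — with the tree's Nie–Wang inequality:
  `|Y|·N_{D'}(m) ≤ 2^m·#E`.

WHAT THIS IS NOT: pure linear algebra; no statement about the game; no separation claim.
-/

noncomputable section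

namespace Summit.QuantumAdvantage.AdviceFreeQNC0

open Finset Module
open Literature.Computability.MetaComplexity Literature.Computability.MetaComplexity.Smolensky

namespace CharK

variable {K : Type*} [Field K] {m : ℕ}

/-! ### The normalised transform -/

/-- `κ(a) = Πᵢ κ(aᵢ)`. -/
def kapProd (ω : K) (a : Fin m → Bool) : K := ∏ i, kapW ω (a i)

/-- `κ(a) ≠ 0`. -/
theorem kapProd_ne_zero {ω : K} (hω : ω ^ 2 + ω + 1 = 0) (h3 : (3 : K) ≠ 0) (a : Fin m → Bool) :
    kapProd ω a ≠ 0 :=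
  Finset.prod_ne_zero_iff.2 fun i _ => kapW_ne_zero hω h3 (a i)

/-- **The coefficient transform** `Θ_Y(Q)(a) = [a ∈ Y] · κ(a)⁻¹ · L_a(Q)`. -/
def thetaK (ω : K) (Y : Finset (Fin m → Bool)) : CubeFn K m →ₗ[K] ((Fin m → Bool) → K) where
  toFun Q := fun a => if a ∈ Y then (kapProd ω a)⁻¹ * LfunK ω a Q else 0
  map_add' Q R := by
    funext a
    by_cases ha : a ∈ Y
    · simp only [if_pos ha, Pi.add_apply, LfunK_add, mul_add]
    · simp only [if_neg ha, Pi.add_apply, add_zero]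
  map_smul' c Q := by
    funext a
    by_cases ha : a ∈ Y
    · simp only [if_pos ha, Pi.smul_apply, smul_eq_mul, RingHom.id_apply, LfunK_smul]
      ring
    · simp only [if_neg ha, Pi.smul_apply, smul_zero, RingHom.id_apply]

/-- Pointwise formula for `thetaK`. -/
theorem thetaK_apply (ω : K) (Y : Finset (Fin m → Bool)) (Q : CubeFn K m) (a : Fin m → Bool) :
    thetaK ω Y Q a = if a ∈ Y then (kapProd ω a)⁻¹ * LfunK ω a Q else 0 :=
  rfl

/-- `τ(aᵢ) = σ(aᵢ) · κ(aᵢ)⁻¹`. -/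
def tauW (ω : K) (ai : Bool) : K := sgnW ai * (kapW ω ai)⁻¹

/-- `τ(2) − τ(1)` is a unit: `(τ(2) − τ(1))·(ω − 1)(1 − ω²) = ω(ω − 1) ≠ 0`. -/
theorem tau_diff_ne_zero {ω : K} (hω : ω ^ 2 + ω + 1 = 0) (h3 : (3 : K) ≠ 0) :
    tauW ω true - tauW ω false ≠ 0 := by
  have h1 : ω - 1 ≠ 0 := omega_sub_one_ne_zero hω h3
  have h2 : 1 - ω ^ 2 ≠ 0 := one_sub_omega_sq_ne_zero hω h3
  have e : (tauW ω true - tauW ω false) * ((ω - 1) * (1 - ω ^ 2)) = ω * (ω - 1) := by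
    unfold tauW sgnW kapW
    simp only [if_true, Bool.false_eq_true, if_false]
    rw [sub_mul, mul_assoc, mul_assoc, ← mul_assoc (ω - 1)⁻¹, inv_mul_cancel₀ h1, one_mul,
      mul_comm (ω - 1) (1 - ω ^ 2), ← mul_assoc (1 - ω ^ 2)⁻¹, inv_mul_cancel₀ h2, one_mul]
    ring
  intro h
  rw [h, zero_mul] at e
  exact mul_ne_zero (omega_ne_zero hω) h1 e.symm

/-- the subset indicators `e_T(a) = [T ⊆ supp a]` restricted to `Y`. -/
def eYK (K : Type*) [Field K] (Y : Finset (Fin m → Bool)) (T : Finset (Fin m)) :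
    (Fin m → Bool) → K :=
  fun a => if a ∈ Y then mono K T a else 0

/-- `Π_{i∈S} τ(aᵢ) = Σ_{T ⊆ S} (τ₂−τ₁)^{|T|} τ₁^{|S∖T|} u^T(a)` (expand `τ(aᵢ) = τ₁ + (τ₂−τ₁)[aᵢ]`). -/
theorem prod_tauW_eq (ω : K) (a : Fin m → Bool) (S : Finset (Fin m)) :
    ∏ i ∈ S, tauW ω (a i) =
      ∑ T ∈ S.powerset, (tauW ω true - tauW ω false) ^ T.card * tauW ω false ^ (S \ T).card *
        mono K T a := by
  classical
  have e : ∀ i ∈ S, tauW ω (a i) = (tauW ω true - tauW ω false) * ιK K (a i) + tauW ω false := by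
    intro i _
    unfold ιK
    cases a i <;> simp
  rw [Finset.prod_congr rfl e, Finset.prod_add]
  refine Finset.sum_congr rfl fun T _ => ?_
  rw [Finset.prod_const, Finset.prod_mul_distrib, Finset.prod_const, mono_eq_prod_ιK]
  ring

/-- **The transform of a monomial is triangular in the subset indicators**:
`Θ_Y(u^S) = Σ_{T ⊆ S} (τ₂−τ₁)^{|T|} τ₁^{|S∖T|} · e_T|_Y`. -/
theorem thetaK_mono {ω : K} (hω : ω ^ 2 + ω + 1 = 0) (h3 : (3 : K) ≠ 0)
    (Y : Finset (Fin m → Bool)) (S : Finset (Fin m)) :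
    thetaK ω Y (mono K S) =
      ∑ T ∈ S.powerset, ((tauW ω true - tauW ω false) ^ T.card * tauW ω false ^ (S \ T).card) •
        eYK K Y T := by
  classical
  funext a
  rw [Finset.sum_apply, thetaK_apply]
  by_cases ha : a ∈ Y
  · rw [if_pos ha, LfunK_mono]
    -- `κ(a)⁻¹ · (Π_S σ)(Π_{∁S} κ) = Π_S τ`
    have hsplit : kapProd ω a = (∏ i ∈ univ \ S, kapW ω (a i)) * ∏ i ∈ S, kapW ω (a i) := by
      unfold kapProd
      exact (Finset.prod_sdiff (Finset.subset_univ S)).symm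
    have hB : (∏ i ∈ univ \ S, kapW ω (a i)) ≠ 0 :=
      Finset.prod_ne_zero_iff.2 fun i _ => kapW_ne_zero hω h3 (a i)
    have hC : (∏ i ∈ S, kapW ω (a i)) ≠ 0 :=
      Finset.prod_ne_zero_iff.2 fun i _ => kapW_ne_zero hω h3 (a i)
    have step : (kapProd ω a)⁻¹ * ((∏ i ∈ S, sgnW (a i)) * ∏ i ∈ univ \ S, kapW ω (a i)) =
        ∏ i ∈ S, tauW ω (a i) := by
      rw [hsplit, mul_inv]
      unfold tauW
      rw [Finset.prod_mul_distrib, Finset.prod_inv_distrib]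
      field_simp
    rw [step, prod_tauW_eq]
    refine Finset.sum_congr rfl fun T _ => ?_
    unfold eYK
    rw [Pi.smul_apply, if_pos ha, smul_eq_mul]
  · rw [if_neg ha]
    symm
    exact Finset.sum_eq_zero fun T _ => by unfold eYK; rw [Pi.smul_apply, if_neg ha, smul_zero]

/-- **Inversion**: every subset indicator `e_T|_Y` with `|T| ≤ D'` is the transform of some
polynomial of degree `≤ D'` (strong induction on `|T|` along the triangular system, whose diagonal
`(τ₂−τ₁)^{|T|}` is a unit). -/
theorem eYK_mem_range {ω : K} (hω : ω ^ 2 + ω + 1 = 0) (h3 : (3 : K) ≠ 0)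
    (Y : Finset (Fin m → Bool)) (D' : ℕ) (S : Finset (Fin m)) (hSD : S.card ≤ D') :
    eYK K Y S ∈ LinearMap.range ((thetaK ω Y).domRestrict (lowDeg K m D')) := by
  classical
  induction' hk : S.card using Nat.strong_induction_on with k ih generalizing S
  have hmono : thetaK ω Y (mono K S) ∈
      LinearMap.range ((thetaK ω Y).domRestrict (lowDeg K m D')) :=
    ⟨⟨mono K S, mono_mem_lowDeg hSD⟩, rfl⟩
  rw [thetaK_mono hω h3] at hmono
  have hSF : S ∈ S.powerset := mem_powerset_self S
  rw [← add_sum_erase _ _ hSF] at hmono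
  have hrest : ∑ T ∈ S.powerset.erase S,
      ((tauW ω true - tauW ω false) ^ T.card * tauW ω false ^ (S \ T).card) • eYK K Y T ∈
      LinearMap.range ((thetaK ω Y).domRestrict (lowDeg K m D')) := by
    refine Submodule.sum_mem _ fun T hT => ?_
    have hT' := mem_erase.1 hT
    have hTS : T ⊆ S := mem_powerset.1 hT'.2
    have hlt : T.card < S.card := card_lt_card (Finset.ssubset_iff_subset_ne.2 ⟨hTS, hT'.1⟩)
    exact Submodule.smul_mem _ _ (ih T.card (hk ▸ hlt) T (by omega) rfl)
  have h := Submodule.sub_mem _ hmono hrest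
  rw [add_sub_cancel_right, Finset.sdiff_self, Finset.card_empty, pow_zero, mul_one] at h
  have hunit : (tauW ω true - tauW ω false) ^ S.card ≠ 0 := pow_ne_zero _ (tau_diff_ne_zero hω h3)
  have h' := Submodule.smul_mem _ ((tauW ω true - tauW ω false) ^ S.card)⁻¹ h
  rwa [smul_smul, inv_mul_cancel₀ hunit, one_smul] at h'

/-- Pointwise formula for the tree's restriction map `projOn`. -/
theorem projOn_apply_K (Y : Finset (Fin m → Bool)) (v : CubeFn K m) (x : Fin m → Bool) :
    projOn K Y v x = if x ∈ Y then v x else 0 :=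
  rfl

/-- **The transform sees all of `(lowDeg D')|_Y`.** -/
theorem map_projOn_le_range {ω : K} (hω : ω ^ 2 + ω + 1 = 0) (h3 : (3 : K) ≠ 0)
    (Y : Finset (Fin m → Bool)) (D' : ℕ) :
    (lowDeg K m D').map (projOn K Y) ≤
      LinearMap.range ((thetaK ω Y).domRestrict (lowDeg K m D')) := by
  rw [lowDeg_eq_span, Submodule.map_span, Submodule.span_le]
  rintro _ ⟨_, ⟨⟨S, hS⟩, rfl⟩, rfl⟩
  have e : (projOn K Y) (mono K S) = eYK K Y S := by
    funext a
    rw [projOn_apply_K]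
    rfl
  rw [e]
  exact eYK_mem_range hω h3 Y D' S hS

/-- **THE RANK FORM over `K`**: if every `Q ∈ lowDeg K m D'` vanishing on `E` satisfies
`L_a(Q) = 0` for all `a ∈ Y`, then `h_{D'}(Y) ≤ #E`. -/
theorem hilbertFn_le_card_of_vanish {ω : K} (hω : ω ^ 2 + ω + 1 = 0) (h3 : (3 : K) ≠ 0)
    (Y E : Finset (Fin m → Bool)) (D' : ℕ)
    (hvan : ∀ Q : CubeFn K m, Q ∈ lowDeg K m D' → (∀ u ∈ E, Q u = 0) → ∀ a ∈ Y, LfunK ω a Q = 0) :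
    hilbertFn K Y D' ≤ E.card := by
  classical
  set V := lowDeg K m D' with hV
  set Θ : V →ₗ[K] ((Fin m → Bool) → K) := (thetaK ω Y).domRestrict V with hΘ
  set R : V →ₗ[K] (↥E → K) :=
    (LinearMap.funLeft K K (fun u : ↥E => (u.1 : Fin m → Bool))).comp V.subtype with hR
  have hker : LinearMap.ker R ≤ LinearMap.ker Θ := by
    intro Q hQ
    rw [LinearMap.mem_ker] at hQ ⊢
    have hQE : ∀ u ∈ E, (Q : CubeFn K m) u = 0 := by
      intro u hu
      have h := congrFun hQ ⟨u, hu⟩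
      simpa [hR, LinearMap.funLeft_apply] using h
    rw [hΘ, LinearMap.domRestrict_apply]
    funext a
    rw [thetaK_apply, Pi.zero_apply]
    by_cases ha : a ∈ Y
    · rw [if_pos ha, hvan Q Q.2 hQE a ha, mul_zero]
    · rw [if_neg ha]
  have h1 : finrank K (LinearMap.range Θ) ≤ finrank K (LinearMap.range R) := by
    have e1 := LinearMap.finrank_range_add_finrank_ker Θ
    have e2 := LinearMap.finrank_range_add_finrank_ker R
    have e3 := Submodule.finrank_mono hker
    omega
  have h2 : finrank K (LinearMap.range R) ≤ E.card := by
    calc finrank K (LinearMap.range R) ≤ finrank K (↥E → K) := Submodule.finrank_le _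
      _ = E.card := by rw [Module.finrank_fintype_fun_eq_card, Fintype.card_coe]
  have h3' : hilbertFn K Y D' ≤ finrank K (LinearMap.range Θ) := by
    unfold hilbertFn
    exact Submodule.finrank_mono (map_projOn_le_range hω h3 Y D')
  omega

/-- **Tube bound shape**: under the same hypothesis, `|Y|·N_{D'}(m) ≤ 2^m·#E` (Nie–Wang). -/
theorem card_mul_numMonomials_le_of_vanish {ω : K} (hω : ω ^ 2 + ω + 1 = 0) (h3 : (3 : K) ≠ 0)
    (Y E : Finset (Fin m → Bool)) (D' : ℕ)
    (hvan : ∀ Q : CubeFn K m, Q ∈ lowDeg K m D' → (∀ u ∈ E, Q u = 0) → ∀ a ∈ Y, LfunK ω a Q = 0) :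
    Y.card * numMonomials m D' ≤ 2 ^ m * E.card := by
  have h1 := numMonomials_mul_card_le_two_pow_mul_hilbertFn (F := K) Y D'
  have h2 := hilbertFn_le_card_of_vanish hω h3 Y E D' hvan
  calc Y.card * numMonomials m D' = numMonomials m D' * Y.card := Nat.mul_comm _ _
    _ ≤ 2 ^ m * hilbertFn K Y D' := h1
    _ ≤ 2 ^ m * E.card := Nat.mul_le_mul_left _ h2

end CharK

end Summit.QuantumAdvantage.AdviceFreeQNC0

end
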